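import Mathlib.Algebra.BigOperators.Fin
import Mathlib.Tactic.FinCases
import Mathlib.Tactic.Ring
import Summits.HodgeConjecture.CorCM.Census.CyclicSexticFaces

/-!
# Cyclic sextic CM fields: every Hodge class on every `B^a × E^b` comes from the two `k`-Weil classes of the fourfold `B × E` — kernel census

COR-CM (cell `pub-hodgecm2`), count-neutral sequel to `Census/CyclicSexticFaces.lean` (this seat's g2 file; model `Pt = ℤ/6 ⊔ ℤ/2`,
`act`, `phi`: `F` a cyclic sextic CM field, `B` its simple CM threefold of type `{0,1,2}`, `E` the CM elliptic curve of the
imaginary quadratic subfield `k = F^{⟨σ²⟩}`; `census_BE`: `B²(B × E) = D² ⊕ W_k`, `W_k` the `k`-Weil plane of the Weil-type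
fourfold `(B × E, k)`).  PORTFOLIO seat lit-andre-3 (gen 7), species-basis method of `Census/DihedralFourCoreLattice.lean`; cell
note `HOME/pub-hodgecm2-lit-andre-3/PORTFOLIO-lit-andre-3-g7.md` §9.  No named fact, no geometry, no `sorry`.

KERNEL: `kwSet_census` (the two `k`-Weil sets, opposite modulo pairs); the six Hodge forms on exponent vectors `m : Pt → ℤ` of
power-products `B^a × E^b` (`hodgeForm`, bridge `hodgeForm_wt`, `hodgeForm_expand`); `isHodgeVec_iff` (LATTICE THEOREM): Hodge ⟺
integral combination of the four conjugate pairs and `kw 0` (rank `5 = 4 + rank L/MT = 4 + (3+1+1) − 4`; `combo_eq_zero`: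
basis); `isHodgeVec_iff_monoid` (MONOID FORM, `m ≥ 0`, both `k`-Weil sets with non-negative multiplicities).  Exact oracle
`scratch/c6_species.py` (also: adding a second CM elliptic curve `E′` with field disjoint from `F` adds one pair and nothing
else — Hodge lattice rank `6 = 5 + 1`, index `1`; not re-decided here).

THEOREM (cell note §9; dictionary CITED as in the companion files, not formalised).  Let `F` be a cyclic CM field of degree
`6`, `B` a simple CM abelian threefold with CM by `F` (all primitive types are twists of one), `E` the CM elliptic curve of the
imaginary quadratic subfield `k ⊂ F`.  For every abelian variety `Z` isogenous to `B^a × E^b` (`a, b ≥ 0`; dimension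
`3a + b`), every Hodge class on `Z` is algebraic PROVIDED the `k`-Weil classes of the single abelian FOURFOLD of Weil type
`B × E` are — Markman's theorem [cite: Markman2025SurveySecant, Thm 1.2] (the cell's hypothesis `hW4`, tree record
`Markman2025_weilClasses_algebraic_abelianFourfold`).  So, modulo that published theorem, HC holds on the whole tower
`{B^a × E^b}` — beyond the dimension-`≤ 5` range of `CMWeights.hodgeConjectureFor_of_isOfCMType_dim_le_five_of_markman`
(e.g. `B² × E`, `B² × E²`, `B³ × E`, …; `B^a` alone carries only products of divisor classes).  Proof: operations (O1)–(O3)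
and argument (O4) of `Census/DihedralFourCoreLattice.lean` with this file's monoid form, the deletion (O3) of a pair spread
over two copies `i, j` of a factor of dimension `g` (`3` for `B`, `1` for `E`) cupping with `m_{ij}^*θ − pr_i^*θ − pr_j^*θ` and
with `pr_i^*θ^{g−1} · pr_j^*θ^{g−1}` before the push-forward (`e_x ∧ e_s ∧ θ^{g−1}` is top iff `s = cx`); generators = the two
`k`-Weil monomials of `B × E` (Markman) and the pair monomials (`NS(B) ⊗ ℚ̄`, `NS(E)`). [cite: Pohlmann1968, Thm 1]

## References
* [Pohlmann1968] H. Pohlmann, Ann. of Math. 88 (1968), Thm 1.  [GaoUllmo2025] Z. Gao, E. Ullmo, JIMJ 25 (2025), Thm 3.1.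
* [MoonenZarhin1999] B. Moonen, Yu. Zarhin, Math. Ann. 315 (1999), Introduction (g).
* [Markman2025SurveySecant] E. Markman, arXiv:2509.23403, Thm 1.2.

## Provenance
Exact oracle `scratch/species.py`, `scratch/c6_species.py`, `scratch/gen_c6.py` (unimodular `5 × 5` minor, integral inverse = witnesses).
-/

namespace Summit.HodgeConjecture.CorCM.Census.CyclicSexticFaces

open Finset

/-- The conjugate pair through a point (a divisor-class monomial of `B` or of `E`). [folklore] -/
def pairOf (x : Pt) : Finset Pt := {x, act 3 x}

/-- The two `k`-Weil sets of the fourfold `B × E` (`census_BE`): `kw t = {σᵗ, σᵗ⁺², σᵗ⁺⁴} ⊔ {e_t}`, `t ∈ ℤ/6` read mod 2.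
[cite: MoonenZarhin1999, Introduction (g)] -/
def kwSet (t : ZMod 6) : Finset Pt := {Sum.inl t, Sum.inl (t + 2), Sum.inl (t + 4), Sum.inr (t.val : ZMod 2)}

set_option maxRecDepth 8000 in
/-- The two `k`-Weil sets are the non-`c`-stable Pohlmann `4`-sets of the first file, and `kw 0 ⊔ kw 1` = the four
conjugate pairs (so `−kw 0 ≡ kw 1` modulo divisor classes). [folklore] -/
theorem kwSet_census : (hodgeSets.filter fun P => ∃ x ∈ P, act 3 x ∉ P) = {kwSet 0, kwSet 1} ∧
    kwSet 0 ∩ kwSet 1 = ∅ ∧ kwSet 0 ∪ kwSet 1 = pairOf (Sum.inl 0) ∪ pairOf (Sum.inl 1) ∪ pairOf (Sum.inl 2) ∪ pairOf (Sum.inr 0) := by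
  refine ⟨by decide +kernel, by decide, by decide⟩

/-- Pohlmann's Hodge functional of `σᵍ` on exponent vectors `m : Pt → ℤ` of power-products `B^a × E^b`. [cite: Pohlmann1968, Thm 1] -/
def hodgeForm (g : ZMod 6) (m : Pt → ℤ) : ℤ := ∑ x : Pt, (if act g x ∈ phi then m x else -m x)

/-- Indicator vector of a set of points. [folklore] -/
def wt (P : Finset Pt) (x : Pt) : ℤ := if x ∈ P then 1 else 0

/-- Bridge to the set census: `hodgeForm g (wt P) = 2|P ∩ g⁻¹Φ| − |P|` (vanishing for `|P| = 2p` iff `eq32 p P`).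
[cite: GaoUllmo2025, Thm 3.1 eq. (3.2)] -/
theorem hodgeForm_wt (g : ZMod 6) (P : Finset Pt) :
    hodgeForm g (wt P) = 2 * ((P.filter fun x => act g x ∈ phi).card : ℤ) - (P.card : ℤ) := by
  classical
  unfold hodgeForm wt
  have hsplit : ∀ x : Pt, (if act g x ∈ phi then (if x ∈ P then (1 : ℤ) else 0) else -(if x ∈ P then (1 : ℤ) else 0))
      = (if x ∈ P.filter (fun x => act g x ∈ phi) then (2 : ℤ) else 0) - (if x ∈ P then (1 : ℤ) else 0) := by
    intro x
    by_cases h1 : act g x ∈ phi <;> by_cases h2 : x ∈ P <;> simp [h1, h2]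
  simp_rw [hsplit]
  rw [Finset.sum_sub_distrib, ← Finset.sum_filter, ← Finset.sum_filter, Finset.sum_const, Finset.sum_const]
  simp only [Finset.filter_mem_eq_inter, Finset.univ_inter, nsmul_eq_mul, mul_one]
  ring

/-- Sums over `ZMod 6 = Fin 6` and `ZMod 2 = Fin 2`. [folklore] -/
theorem sum_zmod6 (f : ZMod 6 → ℤ) : ∑ x : ZMod 6, f x = f 0 + f 1 + f 2 + f 3 + f 4 + f 5 := Fin.sum_univ_six f

/-- Sums over `ZMod 2`. [folklore] -/
theorem sum_zmod2 (f : ZMod 2 → ℤ) : ∑ x : ZMod 2, f x = f 0 + f 1 := Fin.sum_univ_two f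

/-- Case analysis over the eight points. [folklore] -/
theorem forall_pt (p : Pt → Prop) : (∀ x, p x) ↔ p (Sum.inl 0) ∧ p (Sum.inl 1) ∧ p (Sum.inl 2) ∧ p (Sum.inl 3) ∧ p (Sum.inl 4) ∧ p (Sum.inl 5) ∧ p (Sum.inr 0) ∧ p (Sum.inr 1) := by
  constructor
  · intro h
    exact ⟨h _, h _, h _, h _, h _, h _, h _, h _⟩
  · rintro ⟨h0, h1, h2, h3, h4, h5, h6, h7⟩ (i | j)
    · fin_cases i <;> assumption
    · fin_cases j <;> assumption

/-- Case analysis over the six group elements. [folklore] -/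
theorem forall_c6 (p : ZMod 6 → Prop) : (∀ g, p g) ↔ p 0 ∧ p 1 ∧ p 2 ∧ p 3 ∧ p 4 ∧ p 5 := by
  constructor
  · intro h
    exact ⟨h _, h _, h _, h _, h _, h _⟩
  · rintro ⟨h0, h1, h2, h3, h4, h5⟩ g
    fin_cases g <;> assumption

/-- The six Hodge forms, expanded. [cite: Pohlmann1968, Thm 1] -/
theorem hodgeForm_expand (m : Pt → ℤ) :
    hodgeForm 0 m = m (Sum.inl 0) + m (Sum.inl 1) + m (Sum.inl 2) - m (Sum.inl 3) - m (Sum.inl 4) - m (Sum.inl 5) - m (Sum.inr 0) + m (Sum.inr 1) ∧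
    hodgeForm 1 m = m (Sum.inl 0) + m (Sum.inl 1) - m (Sum.inl 2) - m (Sum.inl 3) - m (Sum.inl 4) + m (Sum.inl 5) + m (Sum.inr 0) - m (Sum.inr 1) ∧
    hodgeForm 2 m = m (Sum.inl 0) - m (Sum.inl 1) - m (Sum.inl 2) - m (Sum.inl 3) + m (Sum.inl 4) + m (Sum.inl 5) - m (Sum.inr 0) + m (Sum.inr 1) ∧
    hodgeForm 3 m = -m (Sum.inl 0) - m (Sum.inl 1) - m (Sum.inl 2) + m (Sum.inl 3) + m (Sum.inl 4) + m (Sum.inl 5) + m (Sum.inr 0) - m (Sum.inr 1) ∧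
    hodgeForm 4 m = -m (Sum.inl 0) - m (Sum.inl 1) + m (Sum.inl 2) + m (Sum.inl 3) + m (Sum.inl 4) - m (Sum.inl 5) - m (Sum.inr 0) + m (Sum.inr 1) ∧
    hodgeForm 5 m = -m (Sum.inl 0) + m (Sum.inl 1) + m (Sum.inl 2) + m (Sum.inl 3) - m (Sum.inl 4) - m (Sum.inl 5) + m (Sum.inr 0) - m (Sum.inr 1) := by
  refine ⟨?_, ?_, ?_, ?_, ?_, ?_⟩ <;>
  · simp (config := { decide := true }) only [hodgeForm, Fintype.sum_sum_type, sum_zmod6, sum_zmod2, ↓reduceIte]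
    ring

/-- Integral combinations of the five generators: the pairs of `σ⁰, σ¹, σ²` and of `E` (`a0..a3`) and `kw 0` (`w0`). [folklore] -/
def combo (a0 a1 a2 a3 w0 : ℤ) (x : Pt) : ℤ :=
  a0 * wt (pairOf (Sum.inl 0)) x + a1 * wt (pairOf (Sum.inl 1)) x + a2 * wt (pairOf (Sum.inl 2)) x +
  a3 * wt (pairOf (Sum.inr 0)) x + w0 * wt (kwSet 0) x

/-- `combo` at the eight points. [folklore] -/
theorem combo_expand (a0 a1 a2 a3 w0 : ℤ) :
    combo a0 a1 a2 a3 w0 (Sum.inl 0) = a0 + w0 ∧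
    combo a0 a1 a2 a3 w0 (Sum.inl 1) = a1 ∧
    combo a0 a1 a2 a3 w0 (Sum.inl 2) = a2 + w0 ∧
    combo a0 a1 a2 a3 w0 (Sum.inl 3) = a0 ∧
    combo a0 a1 a2 a3 w0 (Sum.inl 4) = a1 + w0 ∧
    combo a0 a1 a2 a3 w0 (Sum.inl 5) = a2 ∧
    combo a0 a1 a2 a3 w0 (Sum.inr 0) = a3 + w0 ∧
    combo a0 a1 a2 a3 w0 (Sum.inr 1) = a3 := by
  refine ⟨?_, ?_, ?_, ?_, ?_, ?_, ?_, ?_⟩ <;>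
  · simp (config := { decide := true }) only [combo, wt, ↓reduceIte]
    ring

/-- **THE LATTICE THEOREM (cyclic sextic).**  An integer exponent vector on `B × E` is Pohlmann–Hodge for all of `ℤ/6` iff it
is an integral combination of the four conjugate pairs and ONE `k`-Weil set of the fourfold `B × E` (rank `5 = 4 + 1`;
`combo_eq_zero`: basis).  Exact oracle `scratch/c6_species.py`, `gen_c6.py`. [cite: Pohlmann1968, Thm 1] -/
theorem isHodgeVec_iff (m : Pt → ℤ) :
    (∀ g : ZMod 6, hodgeForm g m = 0) ↔ ∃ a0 a1 a2 a3 w0 : ℤ, ∀ x, m x = combo a0 a1 a2 a3 w0 x := by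
  constructor
  · intro h
    rw [forall_c6] at h
    simp only [hodgeForm_expand] at h
    obtain ⟨h0, h1, h2, h3, h4, h5⟩ := h
    refine ⟨m (Sum.inl 3), m (Sum.inl 4) - m (Sum.inr 0) + m (Sum.inr 1), m (Sum.inl 5), m (Sum.inr 1), m (Sum.inr 0) - m (Sum.inr 1), ?_⟩
    rw [forall_pt]
    simp only [combo_expand]
    refine ⟨?_, ?_, ?_, ?_, ?_, ?_, ?_, ?_⟩ <;> first | omega | trivial
  · rintro ⟨a0, a1, a2, a3, w0, hm⟩
    rw [forall_pt] at hm
    simp only [combo_expand] at hm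
    obtain ⟨p0, p1, p2, p3, p4, p5, p6, p7⟩ := hm
    rw [forall_c6]
    simp only [hodgeForm_expand]
    refine ⟨?_, ?_, ?_, ?_, ?_, ?_⟩ <;> omega

/-- The five generators are independent. [folklore] -/
theorem combo_eq_zero (a0 a1 a2 a3 w0 : ℤ) (h : ∀ x, combo a0 a1 a2 a3 w0 x = 0) :
    a0 = 0 ∧ a1 = 0 ∧ a2 = 0 ∧ a3 = 0 ∧ w0 = 0 := by
  rw [forall_pt] at h
  simp only [combo_expand] at h
  omega

/-- Both `k`-Weil sets and the four pairs with coefficients, at a point. [folklore] -/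
def monoidCombo (n0 n1 p0 p1 p2 p3 : ℤ) (x : Pt) : ℤ :=
  n0 * wt (kwSet 0) x + n1 * wt (kwSet 1) x + p0 * wt (pairOf (Sum.inl 0)) x + p1 * wt (pairOf (Sum.inl 1)) x +
  p2 * wt (pairOf (Sum.inl 2)) x + p3 * wt (pairOf (Sum.inr 0)) x

/-- `monoidCombo` at the eight points. [folklore] -/
theorem monoidCombo_expand (n0 n1 p0 p1 p2 p3 : ℤ) :
    monoidCombo n0 n1 p0 p1 p2 p3 (Sum.inl 0) = n0 + p0 ∧
    monoidCombo n0 n1 p0 p1 p2 p3 (Sum.inl 1) = n1 + p1 ∧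
    monoidCombo n0 n1 p0 p1 p2 p3 (Sum.inl 2) = n0 + p2 ∧
    monoidCombo n0 n1 p0 p1 p2 p3 (Sum.inl 3) = n1 + p0 ∧
    monoidCombo n0 n1 p0 p1 p2 p3 (Sum.inl 4) = n0 + p1 ∧
    monoidCombo n0 n1 p0 p1 p2 p3 (Sum.inl 5) = n1 + p2 ∧
    monoidCombo n0 n1 p0 p1 p2 p3 (Sum.inr 0) = n0 + p3 ∧
    monoidCombo n0 n1 p0 p1 p2 p3 (Sum.inr 1) = n1 + p3 := by
  refine ⟨?_, ?_, ?_, ?_, ?_, ?_, ?_, ?_⟩ <;>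
  · simp (config := { decide := true }) only [monoidCombo, wt, ↓reduceIte]
    ring

/-- **MONOID FORM.**  For `m ≥ 0` (a class monomial on some `B^a × E^b`): Hodge ⟺ `m + Σ q·pair = n0·kw 0 + n1·kw 1 + Σ p·pair`
with `n0, n1, p, q ≥ 0` — every Hodge class on every `B^a × E^b` is a product of pull-backs of the two `k`-Weil classes of the
fourfold `B × E` (Markman) and divisor classes, with conjugate pairs deleted (module docstring). [cite: Pohlmann1968, Thm 1] -/
theorem isHodgeVec_iff_monoid (m : Pt → ℤ) (hm : ∀ x, 0 ≤ m x) :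
    (∀ g : ZMod 6, hodgeForm g m = 0) ↔ ∃ n0 n1 p0 p1 p2 p3 q0 q1 q2 q3 : ℤ,
      (0 ≤ n0 ∧ 0 ≤ n1 ∧ 0 ≤ p0 ∧ 0 ≤ p1 ∧ 0 ≤ p2 ∧ 0 ≤ p3 ∧ 0 ≤ q0 ∧ 0 ≤ q1 ∧ 0 ≤ q2 ∧ 0 ≤ q3) ∧
      ∀ x, m x + monoidCombo 0 0 q0 q1 q2 q3 x = monoidCombo n0 n1 p0 p1 p2 p3 x := by
  rw [isHodgeVec_iff]
  rw [forall_pt] at hm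
  obtain ⟨z0, z1, z2, z3, z4, z5, z6, z7⟩ := hm
  constructor
  · rintro ⟨a0, a1, a2, a3, w0, h⟩
    rw [forall_pt] at h
    simp only [combo_expand] at h
    obtain ⟨g0, g1, g2, g3, g4, g5, g6, g7⟩ := h
    refine ⟨max w0 0, max (-w0) 0, max (a0 - max (-w0) 0) 0, max (a1 - max (-w0) 0) 0, max (a2 - max (-w0) 0) 0, max (a3 - max (-w0) 0) 0, max (-(a0 - max (-w0) 0)) 0, max (-(a1 - max (-w0) 0)) 0, max (-(a2 - max (-w0) 0)) 0, max (-(a3 - max (-w0) 0)) 0, ?_, ?_⟩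
    · exact ⟨le_max_right _ _, le_max_right _ _, le_max_right _ _, le_max_right _ _, le_max_right _ _, le_max_right _ _, le_max_right _ _, le_max_right _ _, le_max_right _ _, le_max_right _ _⟩
    · rw [forall_pt]
      simp only [monoidCombo_expand]
      refine ⟨?_, ?_, ?_, ?_, ?_, ?_, ?_, ?_⟩ <;> omega
  · rintro ⟨n0, n1, p0, p1, p2, p3, q0, q1, q2, q3, -, h⟩
    rw [forall_pt] at h
    simp only [monoidCombo_expand] at h
    obtain ⟨g0, g1, g2, g3, g4, g5, g6, g7⟩ := h
    refine ⟨p0 - q0 + n1, p1 - q1 + n1, p2 - q2 + n1, p3 - q3 + n1, n0 - n1, ?_⟩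
    rw [forall_pt]
    simp only [combo_expand]
    refine ⟨?_, ?_, ?_, ?_, ?_, ?_, ?_, ?_⟩ <;> omega

end Summit.HodgeConjecture.CorCM.Census.CyclicSexticFaces
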